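import Literature.AnabelianGeometry.EtaleTheta.Discharge.Sec5Thm510iiiKummerOutOfDictionary
import Literature.AnabelianGeometry.EtaleTheta.Discharge.Sec2AugOpenOfSetting

/-!
# [EtTh] §5, Lemma 5.9 (iv) and Theorem 5.10 (iii) at `DK := kummerOut`, compared with the §1/§2 MODEL of the setting — the `T`-side of the Galois dictionary DISCHARGED (pp. 273, 331–335 / PDF pp. 47, 105–109)

Mochizuki, *The étale theta function and its Frobenioid-theoretic manifestations*, Publ. RIMS **45** (2009)
[cite: MochizukiEtTh2009, Lem 5.9 (iv) p.332 (PDF p.106)]; Def. 2.13 (i) p.273 (PDF p.47); Lemma 5.8 p.331 (PDF p.105);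
Thm. 5.10 (iii) p.334 (PDF p.108).  Layer L2 of the abc-iut cell, seat abc-iut-L2-t11 (gen 4); MERGE-PLAN rows 9/11 of the
§5 owner abc-iut-L2-t4 (HOME/staging/L2/L2-t4/MERGE-PLAN.md: "`T :=` abc-iut-L2-t8's `EtaleThetaData.DoubleUnderline.thetaEnvData`;
… then `IdentifiesPiY/PiYdd` are `rfl`-level, … `ConstOut/KummerOut` = rows 11/6") AT THE SETTING, now that the §5 data of the
setting exist (abc-iut-L2-t4's `ofThetaSettingData`, `Discharge/Sec5OfThetaSetting.lean`, p433549).  PROOF-ONLY (0 defs).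

WHAT IS PROVED.  For ANY §5 data `𝔉` (with the natural action `α` on `O^×(B_N^birat)`) compared with abc-iut-L2-t8's model
`T := C.thetaEnvData μ hC hS` of the setting `D` at level `N := 𝔉.N` along `ι : Π^tp_X̲ ≃ Π^tp_X̲̲(setting)` (at the junction
`𝔉 := ofThetaSettingData …`, `ι := id` and `𝔉.N = N` by `rfl`), this seat's gen-3 Galois-dictionary theorems
(`Discharge/Sec5KummerGaloisDictionary.lean` p424113, `…Transfers.lean` p427083, `Sec5Thm510iiiKummerOutOfDictionary.lean`
p435043) are instantiated with the `T`-SIDE OF THE DICTIONARY DISCHARGED by gen 3's `Discharge/Sec2GaloisDictionaryOfSetting.lean`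
(p425662) and `Sec2AugOpenOfSetting.lean` (p427479):
`e := Gal-identification G_K ≃* Gal(ℚ̄_p/K)` (`Literature.FieldTheory.Galois.fixingSubgroupMulEquiv D.K`), `j := μ_N(ℚ̄_p) ↪ ℚ̄_p^×`,
`hj` (injective), `hjN` (onto the `N`-torsion), `hchi` ("`χ` IS the Galois action on `μ_N`", `thetaEnvData_chi_dictionary`),
`haugY` (`Π^tp_Y̲̲ ↠ G_K` onto, `thetaEnvData_augY_surjective`), `[Normal K ℚ̄_p]`, `[NeZero N]`, and `hopen` ⟸ the ONE
`D`-indexed clause «`Π^tp_X → G_K` is open» (`hopenX`, the `G_K`-valued form of `thetaEnvData_isOpenMap_augY_of_isOpenMap_aug`,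
GAP G-L2t11-3; refuted at the discrete root model, holds at `modelχ`, and derivable from temperedness + Galois-countability by
abc-iut-w5-d111's `TemperedCurve.isOpenMap_augGK_of_isTempered`).  RESULTS:
* `envIsoBiTheta_kummerOut_ofSetting` — [EtTh] Lemma 5.9 (iv) (abc-iut-L2-t4's `EnvIsoBiTheta`) at the honest `K^×`-part
  `DK := kummerOut` against the model of the setting; `frdIsMonoThetaEnv_kummerOut_ofSetting` — its "In particular" = the
  [IUTchII] Prop. 1.2 (ii) binder `hM` for `𝕄 := frdMonoThetaEnv … (kummerOut)`;
* `D_kummerOut_eq_ofSetting` — `D(kummerOut) = D(DK₀)`; `monoThetaEnvCompat_kummerOut_ofSetting` — Theorem 5.10 (iii)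
  (abc-iut-L2-t4's `MonoThetaEnvCompat`) at `DK := kummerOut` against the model of the setting (route (B) of p435043, clause
  `hΔ` explicit).
RESIDUAL BINDERS (all named in the signatures; none a Prop-valued definition) = exactly the `F`-SIDE of the dictionary,
"the `N`-th roots of constants `(K^×)^{1/N} ⊆ O^×(B_N^birat)` read in `ℚ̄_p`": `ν : (K^×)^{1/N} →* ℚ̄_p^×` with `hνμ` (agrees with
`m` on `μ_N(B_N)`), `hνeq` (the birational Galois action of `s^⊓-gp_N(ρ(y))` is the Galois action of `aug(ι y) ∈ G_K`), `hνN`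
(reaches an `N`-th root of every element of `K`) — [EtTh] Def. 3.6 (iv) "`C^{bs-fld}`" (the base-field hull of the tempered
Frobenioid: `O^×` of an object is `O^×` of its base field), the SAME junction datum abc-iut-L2-t4 names for Lemma 5.8's `hgc`
(GAP G-L2t4-4) — together with the cyclotome identification `m`, `IdentifiesPiY/PiYdd` (rfl at `ι := id`), the Prop. 5.2 (iii)
dictionary `hcompat` (F-0521), `KxRootNModCyclotome`, the §5 named inputs, «aug open», and for Thm. 5.10 (iii) the clause `hΔ`
(⟸ Cor. 2.18 (i), F-0620).  Universe: the comparison forces `Hom`-universe `0` for the category of `𝔉` (the setting's groups live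
in `Type`), as at the junction.
HONEST FRAMING: kernel-checked compositions of landed theorems; nothing of [EtTh] is asserted unconditionally; no existence of the
§5 data for an actual curve is claimed; typed ≠ proved; no side is taken on anything downstream ([IUTchIII] Cor. 3.12).
-/

noncomputable section

namespace Literature.AnabelianGeometry.EtaleTheta

open CategoryTheory Literature.AnabelianGeometry.SemiGraphs
open scoped Pointwise

universe w u u' v'

namespace ThetaSetting.EtaleThetaData.DoubleUnderline

variable {p : ℕ} [Fact p.Prime] {D : ThetaSetting p}

/-- The Galois identification `e := G_K ≃* Gal(ℚ̄_p/K)` of the dictionary acts on `ℚ̄_p^×` as `G_K ≤ Gal(ℚ̄_p/ℚ_p)` does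
(bookkeeping: `e σ = σ` as a map of `ℚ̄_p`).  [cite: MochizukiEtTh2009, Def 2.13 (i) p.273 (PDF p.47)] -/
theorem fixingSubgroupMulEquiv_refl_smul_units (g : D.GK) (z : (PadicAlgCl p)ˣ) :
    Literature.FieldTheory.Galois.fixingSubgroupMulEquiv D.K
        (AlgEquiv.refl : PadicAlgCl p ≃ₐ[D.K] PadicAlgCl p) g • z =
      (g : GQp p) • z := by
  apply Units.ext
  rw [AlgEquiv.smul_units_def, AlgEquiv.smul_units_def, Units.coe_map, Units.coe_map, MonoidHom.coe_coe,
    MonoidHom.coe_coe, Literature.FieldTheory.Galois.fixingSubgroupMulEquiv_apply, AlgEquiv.refl_symm,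
    AlgEquiv.coe_refl, id_eq, id_eq]

end ThetaSetting.EtaleThetaData.DoubleUnderline

namespace ThetaFrobenioid

variable {C₀ : Type u} [Category.{0} C₀] {D₀ : Type u'} [Category.{v'} D₀] {𝔉 : ThetaFrobenioid.{w} C₀ D₀}

namespace BiratAutAction

variable (α : 𝔉.BiratAutAction) (hK : 𝔉.KxRootNModCyclotome) (h1 : 𝔉.SectionsFactor)
  (h3 : 𝔉.OuterActionLZ) (hsec : 𝔉.SgpCapSection) (hcs : 𝔉.SgpCupSection) (h8 : 𝔉.ConstantsEqNormalizer)
  {p : ℕ} [Fact p.Prime] {D : ThetaSetting p} {E : D.EtaleThetaData} {l : ℕ} (Cu : E.DoubleUnderline l)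
  (μ : D.CyclotomeMod l 𝔉.N) (hC : D.Compat) (hS : D.Sec2Hyps)
  (ι : 𝔉.PiX ≃ₜ* (Cu.thetaEnvData μ hC hS).PiX) (m : 𝔉.muTorsion 𝔉.BN 𝔉.N ≃* (Cu.thetaEnvData μ hC hS).mu)
  (ν : 𝔉.KxRootN →* (PadicAlgCl p)ˣ)

/-- The `hνeq` clause in the `G_K ≤ Gal(ℚ̄_p/ℚ_p)` form implies the `e`-form the generic dictionary theorems consume.
[cite: MochizukiEtTh2009, Lem 5.8 proof p.331 (PDF p.105)] -/
theorem hνeq_of_smul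
    (hνeq : ∀ (f : 𝔉.KxRootN) (y : 𝔉.PiX),
      (((m (α.kummerCocycle hK f (𝔉.sgpCap (𝔉.ρ y))) : MuN p 𝔉.N) : (PadicAlgCl p)ˣ)) * ν f =
        (((Cu.thetaEnvData μ hC hS).aug (ι y) : D.GK) : GQp p) • ν f)
    (f : 𝔉.KxRootN) (y : 𝔉.PiX) :
    (rootsOfUnity 𝔉.N (PadicAlgCl p)).subtype (m (α.kummerCocycle hK f (𝔉.sgpCap (𝔉.ρ y)))) * ν f =
      Literature.FieldTheory.Galois.fixingSubgroupMulEquiv D.K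
          (AlgEquiv.refl : PadicAlgCl p ≃ₐ[D.K] PadicAlgCl p)
          ((Cu.thetaEnvData μ hC hS).aug (ι y)) • ν f := by
  rw [ThetaSetting.EtaleThetaData.DoubleUnderline.fixingSubgroupMulEquiv_refl_smul_units, Subgroup.subtype_apply]
  exact hνeq f y

/-- **[EtTh] Lemma 5.9 (iv) at the honest `K^×`-part `DK := kummerOut`, compared with the §1/§2 MODEL OF THE SETTING**
(abc-iut-L2-t8's `thetaEnvData` at level `𝔉.N`): abc-iut-L2-t4's `EnvIsoBiTheta` ("the natural inclusions `μ_N(B_N) ↪ E_N`,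
`Im(Π^tp_Y) ⊆ E_N` determine an isomorphism of topological groups `E^Π_N ⥲ Π^tp_Y[μ_N]` which is an isomorphism of mod `N`
bi-theta environments"), with the `T`-side of the Galois dictionary DISCHARGED (`e`, `j`, `hj`, `hjN`, `hchi`, `haugY`; `hopen`
⟸ «`Π^tp_X → G_K` open»).  Residual: `ν`, `hνμ`, `hνeq`, `hνN` ("constants read in `ℚ̄_p`"), `m`, `hY`, `hYdd`, `hcompat`
(F-0521), `KxRootNModCyclotome`, the §5 named inputs.  [cite: MochizukiEtTh2009, Lem 5.9 (iv) p.332 (PDF p.106)] -/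
theorem envIsoBiTheta_kummerOut_ofSetting (H : 𝔉.Facts)
    (hY : 𝔉.IdentifiesPiY (Cu.thetaEnvData μ hC hS) ι.toMulEquiv)
    (hYdd : 𝔉.IdentifiesPiYdd (Cu.thetaEnvData μ hC hS) ι.toMulEquiv) (hopenX : IsOpenMap fun x : D.PiTemp => (⟨D.aug x, D.aug_mem_GK x⟩ : D.GK))
    (hνμ : ∀ u : 𝔉.muTorsion 𝔉.BN 𝔉.N,
      ν ⟨𝔉.muToBirat u, 𝔉.muToBirat_mem_KxRootN u⟩ = ((m u : MuN p 𝔉.N) : (PadicAlgCl p)ˣ))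
    (hνeq : ∀ (f : 𝔉.KxRootN) (y : 𝔉.PiX),
      (((m (α.kummerCocycle hK f (𝔉.sgpCap (𝔉.ρ y))) : MuN p 𝔉.N) : (PadicAlgCl p)ˣ)) * ν f =
        (((Cu.thetaEnvData μ hC hS).aug (ι y) : D.GK) : GQp p) • ν f)
    (hνN : ∀ y : (D.K)ˣ, ∃ f : 𝔉.KxRootN,
      ((ν f : (PadicAlgCl p)ˣ) : PadicAlgCl p) ^ (𝔉.N : ℕ) =
        algebraMap D.K (PadicAlgCl p) y)
    {η : (Cu.thetaEnvData μ hC hS).PiYdd → (Cu.thetaEnvData μ hC hS).mu}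
    (hη : η ∈ (Cu.thetaEnvData μ hC hS).thetaCocycles)
    (hcompat : 𝔉.ThetaSectionCompat H (Cu.thetaEnvData μ hC hS) ι.toMulEquiv m hYdd η) :
    𝔉.EnvIsoBiTheta h1 h3 hsec hcs h8 (α.kummerOut hK) (Cu.thetaEnvData μ hC hS) ι := by
  haveI : IsAlgClosure D.K (PadicAlgCl p) :=
    Literature.FieldTheory.Galois.isAlgClosure_of_intermediateField D.K
  exact α.envIsoBiTheta_birat_of_galoisDictionary hK H h1 h3 hsec hcs h8 (Cu.thetaEnvData μ hC hS) ι m hY hYdd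
    (Literature.FieldTheory.Galois.fixingSubgroupMulEquiv D.K
      (AlgEquiv.refl : PadicAlgCl p ≃ₐ[D.K] PadicAlgCl p))
    (rootsOfUnity 𝔉.N (PadicAlgCl p)).subtype ν
    (rootsOfUnity 𝔉.N (PadicAlgCl p)).subtype_injective
    (fun z hz => ThetaSetting.EtaleThetaData.DoubleUnderline.mem_range_rootsOfUnity_subtype z hz)
    (Cu.thetaEnvData_chi_dictionary μ hC hS) (fun u => (hνμ u).trans (Subgroup.subtype_apply _).symm)
    (α.hνeq_of_smul hK Cu μ hC hS ι m ν hνeq) hνN (Cu.thetaEnvData_augY_surjective μ hC hS)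
    ((Literature.FieldTheory.Galois.fixingSubgroupContinuousMulEquiv D.K
      (AlgEquiv.refl : PadicAlgCl p ≃ₐ[D.K] PadicAlgCl p)).toHomeomorph.isOpenMap.comp
      (Cu.thetaEnvData_isOpenMap_augY_of_isOpenMap_aug μ hC hS hopenX))
    hη hcompat

/-- **Lemma 5.9 (iv) "In particular" (`FrdIsMonoThetaEnv`: "`E^Π_N` IS a mod `N` mono-theta environment" for the curve data of
the setting) at `DK := kummerOut`** — the [IUTchII] Prop. 1.2 (ii) binder `hM` for print's `𝕄 := ⟨l·ℤ, K^×⟩`-environment, with the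
`T`-side of the dictionary discharged.  [cite: MochizukiEtTh2009, Lem 5.9 (iv) p.332 (PDF p.106)] -/
theorem frdIsMonoThetaEnv_kummerOut_ofSetting (H : 𝔉.Facts)
    (hY : 𝔉.IdentifiesPiY (Cu.thetaEnvData μ hC hS) ι.toMulEquiv)
    (hYdd : 𝔉.IdentifiesPiYdd (Cu.thetaEnvData μ hC hS) ι.toMulEquiv) (hopenX : IsOpenMap fun x : D.PiTemp => (⟨D.aug x, D.aug_mem_GK x⟩ : D.GK))
    (hνμ : ∀ u : 𝔉.muTorsion 𝔉.BN 𝔉.N,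
      ν ⟨𝔉.muToBirat u, 𝔉.muToBirat_mem_KxRootN u⟩ = ((m u : MuN p 𝔉.N) : (PadicAlgCl p)ˣ))
    (hνeq : ∀ (f : 𝔉.KxRootN) (y : 𝔉.PiX),
      (((m (α.kummerCocycle hK f (𝔉.sgpCap (𝔉.ρ y))) : MuN p 𝔉.N) : (PadicAlgCl p)ˣ)) * ν f =
        (((Cu.thetaEnvData μ hC hS).aug (ι y) : D.GK) : GQp p) • ν f)
    (hνN : ∀ y : (D.K)ˣ, ∃ f : 𝔉.KxRootN,
      ((ν f : (PadicAlgCl p)ˣ) : PadicAlgCl p) ^ (𝔉.N : ℕ) =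
        algebraMap D.K (PadicAlgCl p) y)
    {η : (Cu.thetaEnvData μ hC hS).PiYdd → (Cu.thetaEnvData μ hC hS).mu}
    (hη : η ∈ (Cu.thetaEnvData μ hC hS).thetaCocycles)
    (hcompat : 𝔉.ThetaSectionCompat H (Cu.thetaEnvData μ hC hS) ι.toMulEquiv m hYdd η) :
    𝔉.FrdIsMonoThetaEnv h1 h3 hsec hcs h8 (α.kummerOut hK) (Cu.thetaEnvData μ hC hS) :=
  𝔉.frdIsMonoThetaEnv_of h1 h3 hsec hcs h8 (α.kummerOut hK) (Cu.thetaEnvData μ hC hS) ι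
    (α.envIsoBiTheta_kummerOut_ofSetting hK h1 h3 hsec hcs h8 Cu μ hC hS ι m ν H hY hYdd hopenX hνμ hνeq hνN hη
      hcompat)

/-- **`D(kummerOut) = D(DK₀)` against the model of the setting** (this seat's `D_kummerOut_eq_of_galoisDictionary` with the
`T`-side discharged): the intrinsic `K^×`-part and the canonical `DK₀ := (E^Π_N ⥲ Π^tp_Y[μ_N])⁻¹(kummerOut(D_Y))` generate the same
`D ⊆ Out(E^Π_N)`.  [cite: MochizukiEtTh2009, Lem 5.9 (iv) p.332 (PDF p.106)] -/
theorem D_kummerOut_eq_ofSetting (H : 𝔉.Facts)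
    (hY : 𝔉.IdentifiesPiY (Cu.thetaEnvData μ hC hS) ι.toMulEquiv) (hopenX : IsOpenMap fun x : D.PiTemp => (⟨D.aug x, D.aug_mem_GK x⟩ : D.GK))
    (hνμ : ∀ u : 𝔉.muTorsion 𝔉.BN 𝔉.N,
      ν ⟨𝔉.muToBirat u, 𝔉.muToBirat_mem_KxRootN u⟩ = ((m u : MuN p 𝔉.N) : (PadicAlgCl p)ˣ))
    (hνeq : ∀ (f : 𝔉.KxRootN) (y : 𝔉.PiX),
      (((m (α.kummerCocycle hK f (𝔉.sgpCap (𝔉.ρ y))) : MuN p 𝔉.N) : (PadicAlgCl p)ˣ)) * ν f =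
        (((Cu.thetaEnvData μ hC hS).aug (ι y) : D.GK) : GQp p) • ν f)
    (hνN : ∀ y : (D.K)ˣ, ∃ f : 𝔉.KxRootN,
      ((ν f : (PadicAlgCl p)ˣ) : PadicAlgCl p) ^ (𝔉.N : ℕ) =
        algebraMap D.K (PadicAlgCl p) y) :
    (𝔉.frdBiThetaEnv h1 h3 hsec hcs h8 (α.kummerOut hK)).D =
      (𝔉.frdBiThetaEnv h1 h3 hsec hcs h8
        (TopOut.transport (𝔉.envContIso H (Cu.thetaEnvData μ hC hS) ι m hY
          (α.cyclotomicCharacterCompatX_of_galoisDictionary hK (Cu.thetaEnvData μ hC hS) ι m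
            (Literature.FieldTheory.Galois.fixingSubgroupMulEquiv D.K
              (AlgEquiv.refl : PadicAlgCl p ≃ₐ[D.K] PadicAlgCl p))
            (rootsOfUnity 𝔉.N (PadicAlgCl p)).subtype ν
            (rootsOfUnity 𝔉.N (PadicAlgCl p)).subtype_injective
            (Cu.thetaEnvData_chi_dictionary μ hC hS)
            (fun u => (hνμ u).trans (Subgroup.subtype_apply _).symm)
            (α.hνeq_of_smul hK Cu μ hC hS ι m ν hνeq)).toY) ⁻¹'
          (Cu.thetaEnvData μ hC hS).kummerOut)).D := by
  haveI : IsAlgClosure D.K (PadicAlgCl p) :=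
    Literature.FieldTheory.Galois.isAlgClosure_of_intermediateField D.K
  exact α.D_kummerOut_eq_of_galoisDictionary hK H h1 h3 hsec hcs h8 (Cu.thetaEnvData μ hC hS) ι m hY
    (Literature.FieldTheory.Galois.fixingSubgroupMulEquiv D.K
      (AlgEquiv.refl : PadicAlgCl p ≃ₐ[D.K] PadicAlgCl p))
    (rootsOfUnity 𝔉.N (PadicAlgCl p)).subtype ν
    (rootsOfUnity 𝔉.N (PadicAlgCl p)).subtype_injective
    (fun z hz => ThetaSetting.EtaleThetaData.DoubleUnderline.mem_range_rootsOfUnity_subtype z hz)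
    (Cu.thetaEnvData_chi_dictionary μ hC hS) (fun u => (hνμ u).trans (Subgroup.subtype_apply _).symm)
    (α.hνeq_of_smul hK Cu μ hC hS ι m ν hνeq) hνN (Cu.thetaEnvData_augY_surjective μ hC hS)
    ((Literature.FieldTheory.Galois.fixingSubgroupContinuousMulEquiv D.K
      (AlgEquiv.refl : PadicAlgCl p ≃ₐ[D.K] PadicAlgCl p)).toHomeomorph.isOpenMap.comp
      (Cu.thetaEnvData_isOpenMap_augY_of_isOpenMap_aug μ hC hS hopenX))

/-- **[EtTh] Theorem 5.10 (iii) (abc-iut-L2-t4's `MonoThetaEnvCompat`) at `DK := kummerOut` against the model of the setting**,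
route (B) of this seat's `Sec5Thm510iiiKummerOutOfDictionary.lean` with the `T`-side of the dictionary discharged: for every
compatible pair `γ` stabilises `kummerOut` (`kummerOut ⊆ DK₀`, abc-iut-L6-t23's stability of `DK₀`, `D(kummerOut) = D(DK₀)`),
granted the clause `hΔ` «every topological automorphism of `Π^tp_X̲` over the comparison preserves `Π^tp_Y̲ ∩ Ker(↠ G_K)`»
([EtTh] Cor. 2.18 (i), F-0620; `aug_iff_of_cor218_i` over a `RigidData`).  Remaining hypotheses as in
`envIsoBiTheta_kummerOut_ofSetting` plus Theorem 5.10 (ii) as typed and the representative `ψY`.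
[cite: MochizukiEtTh2009, Thm 5.10 (iii) p.334–335 (PDF pp.108–109)] -/
theorem monoThetaEnvCompat_kummerOut_ofSetting (H : 𝔉.Facts)
    (hY : 𝔉.IdentifiesPiY (Cu.thetaEnvData μ hC hS) ι.toMulEquiv) (hopenX : IsOpenMap fun x : D.PiTemp => (⟨D.aug x, D.aug_mem_GK x⟩ : D.GK))
    (hνμ : ∀ u : 𝔉.muTorsion 𝔉.BN 𝔉.N,
      ν ⟨𝔉.muToBirat u, 𝔉.muToBirat_mem_KxRootN u⟩ = ((m u : MuN p 𝔉.N) : (PadicAlgCl p)ˣ))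
    (hνeq : ∀ (f : 𝔉.KxRootN) (y : 𝔉.PiX),
      (((m (α.kummerCocycle hK f (𝔉.sgpCap (𝔉.ρ y))) : MuN p 𝔉.N) : (PadicAlgCl p)ˣ)) * ν f =
        (((Cu.thetaEnvData μ hC hS).aug (ι y) : D.GK) : GQp p) • ν f)
    (hνN : ∀ y : (D.K)ˣ, ∃ f : 𝔉.KxRootN,
      ((ν f : (PadicAlgCl p)ˣ) : PadicAlgCl p) ^ (𝔉.N : ℕ) =
        algebraMap D.K (PadicAlgCl p) y)
    (hΔ : ∀ (ψ : 𝔉.PiX ≃ₜ* 𝔉.PiX), ∀ y ∈ 𝔉.PiY,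
      (Cu.thetaEnvData μ hC hS).aug (ι (ψ y)) = 1 ↔ (Cu.thetaEnvData μ hC hS).aug (ι y) = 1)
    (Ψ : C₀ ≌ C₀) (β : Ψ.functor.obj 𝔉.BN ≅ 𝔉.BN) (ΨbiratAut : 𝔉.biratUnits 𝔉.BN ≃* 𝔉.biratUnits 𝔉.BN)
    (hii : 𝔉.PsiAutPreserves Ψ β ΨbiratAut) (ψY : 𝔉.PiX ≃ₜ* 𝔉.PiX)
    (hbase : ∀ g, 𝔉.autBase 𝔉.BN (𝔉.psiAut Ψ β (𝔉.sgpCap (𝔉.ρ g))) = 𝔉.ρ (ψY g))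
    (hψY : 𝔉.PiY.map ψY.toMulEquiv.toMonoidHom = 𝔉.PiY)
    (hψYdd : 𝔉.PiYdd.map ψY.toMulEquiv.toMonoidHom = 𝔉.PiYdd) :
    𝔉.MonoThetaEnvCompat h1 h3 hsec hcs h8 (α.kummerOut hK) Ψ β ψY hbase hψY hψYdd := by
  haveI : IsAlgClosure D.K (PadicAlgCl p) :=
    Literature.FieldTheory.Galois.isAlgClosure_of_intermediateField D.K
  exact monoThetaEnvCompat_of_psiAutPreserves h1 h3 hsec hcs h8 (α.kummerOut hK) Ψ β ΨbiratAut hii ψY hbase hψY hψYdd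
    (fun {Φ} {ψ} hc d hd => α.transport_envAut_mem_D_kummerOut_of_galoisDictionary hK h1 h3 hsec hcs h8
      (Cu.thetaEnvData μ hC hS) ι m
      (Literature.FieldTheory.Galois.fixingSubgroupMulEquiv D.K
        (AlgEquiv.refl : PadicAlgCl p ≃ₐ[D.K] PadicAlgCl p))
      (rootsOfUnity 𝔉.N (PadicAlgCl p)).subtype ν H hY
      (rootsOfUnity 𝔉.N (PadicAlgCl p)).subtype_injective
      (fun z hz => ThetaSetting.EtaleThetaData.DoubleUnderline.mem_range_rootsOfUnity_subtype z hz)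
      (Cu.thetaEnvData_chi_dictionary μ hC hS) (fun u => (hνμ u).trans (Subgroup.subtype_apply _).symm)
      (α.hνeq_of_smul hK Cu μ hC hS ι m ν hνeq) hνN (Cu.thetaEnvData_augY_surjective μ hC hS)
      ((Literature.FieldTheory.Galois.fixingSubgroupContinuousMulEquiv D.K
        (AlgEquiv.refl : PadicAlgCl p ≃ₐ[D.K] PadicAlgCl p)).toHomeomorph.isOpenMap.comp
        (Cu.thetaEnvData_isOpenMap_augY_of_isOpenMap_aug μ hC hS hopenX))
      hc (hΔ ψ) hd)

end BiratAutAction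

end ThetaFrobenioid

end Literature.AnabelianGeometry.EtaleTheta

end
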